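import Summits.Ventures.YMGap.Thresholds.ZeroCouplingResampling
import Summits.Ventures.YMGap.Thresholds.HaarFourthMomentSUNChar
import HarnessLib

/-!
# `SU(N)` plaquette moments of order four under the infinite Haar product `dg_∞` (THE DLR state at `β = 0`), `N ≥ 3`, `N ≠ 4`:
# the WICK RULE HOLDS EXACTLY — `∫ W_a W_b W_c W_e dg_∞ = (δ_abδ_ce + δ_acδ_be + δ_aeδ_bc)/(4N⁴)` — and the joint fourth cumulant
# VANISHES IDENTICALLY (row type C-PRESS, endpoint `β = 0`, part 19e)

Cell `pub-ymgap`, seat ds-1 (gen 11). HONEST FRAMING: exact strong-coupling LATTICE statements AT `β = 0` for `SU(N)` Wilson lattice gauge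
theory on `ℤ^d` (any `d`), `N ≥ 3`, `N ≠ 4`: moments of the plaquette variables `W_p = (1/N) Re tr U_p` under the product Haar measure
`zdHaar d G` for a compact group `G ≅ SU(N)`; nothing about `β > 0`, nothing about the continuum or the Clay problem. Kernel theorems only,
0 compute, no definitions.

Inputs: part 11a (a plaquette of multiplicity one kills the moment; `∫ W_p² W_q² = (E W²)²`; one-plaquette reduction), `E W² = 1/(2N²)`
(`charVariance_eq_half`) and part 19d (`∫ (Re tr U)⁴ dU = 3/4`, i.e. `E W⁴ = 3/(4N⁴) = 3 (E W²)²`). Hence ★★ `suN_integral_mul₃_zdHaar`: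
`∫ W_a W_b W_c W_e dg_∞ = (δ_abδ_ce + δ_acδ_be + δ_aeδ_bc)/(4N⁴)` with NO diagonal correction, and ★★ `suN_fourthCumulant_zdHaar`:
`E[abce] − E[ab]E[ce] − E[ac]E[be] − E[ae]E[bc] = 0` for ALL `a, b, c, e` — in contrast with `SU(2)` (part 11b: `−δ_{a=b=c=e}/16`, the
number behind `f⁗(0) = −6`). For `SU(3)` the plaquette field at `β = 0` is thus Wick/Gaussian at orders 2 and 4 while its third
moments are the non-Gaussian `δ_{a=b=c}/108` (part 15). References: M. Creutz, *Quarks, gluons and lattices* (1983) §8, §10;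
P. Diaconis, M. Shahshahani, J. Appl. Probab. 31A (1994) 49. Everything here is proved. [folklore]
-/

noncomputable section

open MeasureTheory ProbabilityTheory Finset
open Literature.MathematicalPhysics.QuantumLattice (ZdPlaquette plaquetteEdges fundamentalRep plaquetteObs)
open Literature.MathematicalPhysics.QuantumFieldTheory hiding ZdEdge
open Literature.Probability.LatticeModels (Site)

namespace Summit.Ventures.YMGap.ZeroCouplingMoments

section SUN

open Literature.MathematicalPhysics.QuantumFieldTheory.PlaquetteLowerBound (reTr charVariance)

variable {d n : ℕ} {G : Type*} [Group G] [TopologicalSpace G] [IsTopologicalGroup G] [CompactSpace G]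
  [MeasurableSpace G] [BorelSpace G] [SecondCountableTopology G] {ρ : G →* Matrix (Fin (2 + n)) (Fin (2 + n)) ℂ}

/-- Shorthand for this section: the `SU(N)` plaquette variable `W_p = (1/N) Re tr U_p` on `ℤ^d`, `N = 2 + n`. -/
local notation3 (prettyPrint := false) "𝔚" => fun (p : ZdPlaquette d) (U : ZdGaugeConfig d G) =>
  zdPlaquetteObs ρ p.1 p.2.1.1 p.2.1.2 U

/-- Local shorthand: `c_N := 1/(4N⁴) = (E W²)²`, the Wick unit. -/
local notation3 (prettyPrint := false) "cN" => (1 / (4 * ((2 + n : ℕ) : ℝ) ^ 4) : ℝ)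

/-- `SU(N)`, `N ≥ 3`, `N ∤ 4`: `∫ W_p⁴ dg_∞ = 3/(4N⁴) = 3 c_N` (part 19d). [folklore] -/
theorem suN_integral_four_zdHaar (hρ : IsSpecialUnitaryModel ρ) (hn : 1 ≤ n) (h4 : ¬ (2 + n) ∣ 4) (p : ZdPlaquette d) :
    ∫ U, 𝔚 p U * 𝔚 p U * 𝔚 p U * 𝔚 p U ∂zdHaar d G = 3 * cN := by
  have h := integral_pow_four_zdHaar (d := d) (G := G) hρ.1 p
  simp_rw [mul_pow] at h
  rw [integral_const_mul, HaarFourthMomentSUN.integral_reTr_pow_four_SUN ρ hρ hn h4] at h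
  have hN : ((2 + n : ℕ) : ℝ) ≠ 0 := by positivity
  rw [(integral_congr_ae (Filter.Eventually.of_forall fun U => by ring)).trans h]
  field_simp

/-- `SU(N)`, `N ≥ 3`: `∫ W_p W_q dg_∞ = δ_{pq}/(2N²)`. [folklore] -/
theorem suN_integral_mul_zdHaar (hρ : IsSpecialUnitaryModel ρ) (hn : 1 ≤ n) (p q : ZdPlaquette d) :
    ∫ U, 𝔚 p U * 𝔚 q U ∂zdHaar d G = if p = q then 1 / (2 * ((2 + n : ℕ) : ℝ) ^ 2) else 0 := by
  show ∫ U, zdPlaquetteObs ρ p.1 p.2.1.1 p.2.1.2 U * zdPlaquetteObs ρ q.1 q.2.1.1 q.2.1.2 U ∂zdHaar d G = _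
  rw [integral_mul_zdHaar hρ (by omega), RobustBall.HaarSecondMoments.charVariance_eq_half ρ hρ (by omega)]
  split_ifs
  · field_simp
  · rfl

/-- `SU(N)`, `N ≥ 3`, `p ≠ q`: `∫ W_p W_p W_q W_q dg_∞ = 1/(4N⁴) = c_N`. [folklore] -/
theorem suN_integral_pair₁₂_zdHaar (hρ : IsSpecialUnitaryModel ρ) (hn : 1 ≤ n) {p q : ZdPlaquette d} (hpq : p ≠ q) :
    ∫ U, 𝔚 p U * 𝔚 p U * 𝔚 q U * 𝔚 q U ∂zdHaar d G = cN := by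
  have h := integral_sq_mul_sq_zdHaar (d := d) (G := G) hρ hpq
  rw [RobustBall.HaarSecondMoments.charVariance_eq_half ρ hρ (by omega)] at h
  rw [(integral_congr_ae (Filter.Eventually.of_forall fun U => by ring)).trans h]
  have hN : ((2 + n : ℕ) : ℝ) ≠ 0 := by positivity
  field_simp
  ring

/-- `SU(N)`, `p ≠ q`: `∫ W_p W_q W_p W_q dg_∞ = c_N`. [folklore] -/
theorem suN_integral_pair₁₃_zdHaar (hρ : IsSpecialUnitaryModel ρ) (hn : 1 ≤ n) {p q : ZdPlaquette d} (hpq : p ≠ q) :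
    ∫ U, 𝔚 p U * 𝔚 q U * 𝔚 p U * 𝔚 q U ∂zdHaar d G = cN :=
  (integral_congr_ae (Filter.Eventually.of_forall fun U => by ring)).trans (suN_integral_pair₁₂_zdHaar hρ hn hpq)

/-- `SU(N)`, `p ≠ q`: `∫ W_p W_q W_q W_p dg_∞ = c_N`. [folklore] -/
theorem suN_integral_pair₁₄_zdHaar (hρ : IsSpecialUnitaryModel ρ) (hn : 1 ≤ n) {p q : ZdPlaquette d} (hpq : p ≠ q) :
    ∫ U, 𝔚 p U * 𝔚 q U * 𝔚 q U * 𝔚 p U ∂zdHaar d G = cN :=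
  (integral_congr_ae (Filter.Eventually.of_forall fun U => by ring)).trans (suN_integral_pair₁₂_zdHaar hρ hn hpq)

/-- A plaquette occurring exactly once kills a fourth moment (position 1). [folklore] -/
private theorem suN_integral_single₁_zdHaar (hρ : IsSpecialUnitaryModel ρ) {s p q r : ZdPlaquette d} (hp : s ≠ p)
    (hq : s ≠ q) (hr : s ≠ r) : ∫ U, 𝔚 s U * 𝔚 p U * 𝔚 q U * 𝔚 r U ∂zdHaar d G = 0 :=
  (integral_congr_ae (Filter.Eventually.of_forall fun U => by ring)).trans
    (integral_mul₃_eq_zero_of_ne (d := d) (G := G) hρ (by omega) hp hq hr)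

/-- Position 2. [folklore] -/
private theorem suN_integral_single₂_zdHaar (hρ : IsSpecialUnitaryModel ρ) {s p q r : ZdPlaquette d} (hp : s ≠ p)
    (hq : s ≠ q) (hr : s ≠ r) : ∫ U, 𝔚 p U * 𝔚 s U * 𝔚 q U * 𝔚 r U ∂zdHaar d G = 0 :=
  (integral_congr_ae (Filter.Eventually.of_forall fun U => by ring)).trans
    (integral_mul₃_eq_zero_of_ne (d := d) (G := G) hρ (by omega) hp hq hr)

/-- Position 3. [folklore] -/
private theorem suN_integral_single₃_zdHaar (hρ : IsSpecialUnitaryModel ρ) {s p q r : ZdPlaquette d} (hp : s ≠ p)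
    (hq : s ≠ q) (hr : s ≠ r) : ∫ U, 𝔚 p U * 𝔚 q U * 𝔚 s U * 𝔚 r U ∂zdHaar d G = 0 :=
  (integral_congr_ae (Filter.Eventually.of_forall fun U => by ring)).trans
    (integral_mul₃_eq_zero_of_ne (d := d) (G := G) hρ (by omega) hp hq hr)

/-- Position 4. [folklore] -/
private theorem suN_integral_single₄_zdHaar (hρ : IsSpecialUnitaryModel ρ) {s p q r : ZdPlaquette d} (hp : s ≠ p)
    (hq : s ≠ q) (hr : s ≠ r) : ∫ U, 𝔚 p U * 𝔚 q U * 𝔚 r U * 𝔚 s U ∂zdHaar d G = 0 :=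
  (integral_congr_ae (Filter.Eventually.of_forall fun U => by ring)).trans
    (integral_mul₃_eq_zero_of_ne (d := d) (G := G) hρ (by omega) hp hq hr)

/-- ★★ **`SU(N)`, `N ≥ 3`, `N ≠ 4`: THE FOURTH PLAQUETTE MOMENTS AT `β = 0` OBEY WICK'S RULE EXACTLY**:
`∫ W_a W_b W_c W_e dg_∞ = (δ_{ab}δ_{ce} + δ_{ac}δ_{be} + δ_{ae}δ_{bc}) · 1/(4N⁴)` — including the diagonal, where
`E W⁴ = 3/(4N⁴) = 3 (E W²)²`. [folklore] -/
theorem suN_integral_mul₃_zdHaar (hρ : IsSpecialUnitaryModel ρ) (hn : 1 ≤ n) (h4 : ¬ (2 + n) ∣ 4) (a b c e : ZdPlaquette d) :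
    ∫ U, 𝔚 a U * 𝔚 b U * 𝔚 c U * 𝔚 e U ∂zdHaar d G =
      ((if a = b ∧ c = e then 1 else 0) + (if a = c ∧ b = e then 1 else 0) + (if a = e ∧ b = c then 1 else 0)) * cN := by
  by_cases hab : a = b
  · subst hab
    by_cases hac : a = c
    · subst hac
      by_cases hae : a = e
      · subst hae
        rw [suN_integral_four_zdHaar hρ hn h4 a]; norm_num
      · rw [suN_integral_single₄_zdHaar hρ (Ne.symm hae) (Ne.symm hae) (Ne.symm hae)]; norm_num [hae]
    · by_cases hae : a = e
      · subst hae
        rw [suN_integral_single₃_zdHaar hρ (Ne.symm hac) (Ne.symm hac) (Ne.symm hac)]; norm_num [hac, Ne.symm hac]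
      · by_cases hce : c = e
        · subst hce
          rw [suN_integral_pair₁₂_zdHaar hρ hn hac]; norm_num [hac]
        · rw [suN_integral_single₃_zdHaar hρ (Ne.symm hac) (Ne.symm hac) hce]; norm_num [hac, hae, hce]
  · by_cases hac : a = c
    · subst hac
      by_cases hae : a = e
      · subst hae
        rw [suN_integral_single₂_zdHaar hρ (Ne.symm hab) (Ne.symm hab) (Ne.symm hab)]; norm_num [hab, Ne.symm hab]
      · by_cases hbe : b = e
        · subst hbe
          rw [suN_integral_pair₁₃_zdHaar hρ hn hab]; norm_num [hab]
        · rw [suN_integral_single₂_zdHaar hρ (Ne.symm hab) (Ne.symm hab) hbe]; norm_num [hab, hae, hbe]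
    · by_cases hae : a = e
      · subst hae
        by_cases hbc : b = c
        · subst hbc
          rw [suN_integral_pair₁₄_zdHaar hρ hn hab]; norm_num [hab]
        · rw [suN_integral_single₂_zdHaar hρ (Ne.symm hab) hbc (Ne.symm hab)]; norm_num [hab, hac, hbc]
      · rw [suN_integral_single₁_zdHaar hρ hab hac hae]; norm_num [hab, hac, hae]

/-- ★★ **`SU(N)`, `N ≥ 3`, `N ≠ 4`, every `d`: THE JOINT FOURTH CUMULANT OF THE PLAQUETTE VARIABLES VANISHES IDENTICALLY AT `β = 0`**:
`E[abce] − E[ab]E[ce] − E[ac]E[be] − E[ae]E[bc] = 0` for all plaquettes `a, b, c, e` (the means `E W_a` vanish, so this IS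
the full joint cumulant `κ₄`, for `N = 3` as well — the non-zero third moments of `SU(3)` do not enter `κ₄` when the means vanish).
Contrast `SU(2)`: `−δ_{a=b=c=e}/16`. [folklore] -/
theorem suN_fourthCumulant_zdHaar (hρ : IsSpecialUnitaryModel ρ) (hn : 1 ≤ n) (h4 : ¬ (2 + n) ∣ 4) (a b c e : ZdPlaquette d) :
    ∫ U, 𝔚 a U * 𝔚 b U * 𝔚 c U * 𝔚 e U ∂zdHaar d G -
        (∫ U, 𝔚 a U * 𝔚 b U ∂zdHaar d G) * (∫ U, 𝔚 c U * 𝔚 e U ∂zdHaar d G) -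
        (∫ U, 𝔚 a U * 𝔚 c U ∂zdHaar d G) * (∫ U, 𝔚 b U * 𝔚 e U ∂zdHaar d G) -
        (∫ U, 𝔚 a U * 𝔚 e U ∂zdHaar d G) * (∫ U, 𝔚 b U * 𝔚 c U ∂zdHaar d G) = 0 := by
  have hN : ((2 + n : ℕ) : ℝ) ≠ 0 := by positivity
  have key : ∀ (P Q : Prop) [Decidable P] [Decidable Q],
      ((if P then (1 / (2 * ((2 + n : ℕ) : ℝ) ^ 2) : ℝ) else 0) * (if Q then (1 / (2 * ((2 + n : ℕ) : ℝ) ^ 2) : ℝ) else 0)) =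
        (if P ∧ Q then 1 else 0) * cN := by
    intro P Q _ _
    by_cases hP : P <;> by_cases hQ : Q <;> simp [hP, hQ]
    field_simp
    ring
  rw [suN_integral_mul₃_zdHaar hρ hn h4, suN_integral_mul_zdHaar hρ hn, suN_integral_mul_zdHaar hρ hn,
    suN_integral_mul_zdHaar hρ hn, suN_integral_mul_zdHaar hρ hn, suN_integral_mul_zdHaar hρ hn, suN_integral_mul_zdHaar hρ hn,
    key, key, key]
  ring

end SUN

/-! ## The connected four-point function in the tree's vocabulary: `u₄ ≡ 0` at `β = 0` for `SU(N)`, `N ≥ 3`, `N ≠ 4` -/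

section CumulantsSUN

variable {d n : ℕ} {G : Type*} [Group G] [TopologicalSpace G] [IsTopologicalGroup G] [CompactSpace G]
  [MeasurableSpace G] [BorelSpace G] [SecondCountableTopology G] {ρ : G →* Matrix (Fin (2 + n)) (Fin (2 + n)) ℂ}

/-- Shorthand for this section: the `SU(N)` plaquette variable on `ℤ^d`. -/
local notation3 (prettyPrint := false) "𝔚" => fun (p : ZdPlaquette d) (U : ZdGaugeConfig d G) =>
  zdPlaquetteObs ρ p.1 p.2.1.1 p.2.1.2 U

/-- Local shorthand: the connected three-point function `u₃(X; Y; Z)` under `μ` (the tree's spelled-out form). -/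
local notation3 (prettyPrint := false) "U₃[" X ";" Y ";" Z ";" μ "]" =>
  cov[fun ω => X ω * Y ω, Z; μ] - (∫ ω, X ω ∂μ) * cov[Y, Z; μ] - (∫ ω, Y ω ∂μ) * cov[X, Z; μ]

/-- Local shorthand: the connected four-point function in derivative form `u₄(X; Y; Z; W)` under `μ` (g10 file G). -/
local notation3 (prettyPrint := false) "U₄[" X ";" Y ";" Z ";" W ";" μ "]" =>
  (cov[fun ω => (X ω * Y ω) * Z ω, W; μ] - (∫ ω, X ω * Y ω ∂μ) * cov[Z, W; μ] - (∫ ω, Z ω ∂μ) * cov[fun ω => X ω * Y ω, W; μ])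
  - cov[X, W; μ] * cov[Y, Z; μ] - (∫ ω, X ω ∂μ) * U₃[Y ; Z ; W ; μ]
  - cov[Y, W; μ] * cov[X, Z; μ] - (∫ ω, Y ω ∂μ) * U₃[X ; Z ; W ; μ]

omit [CompactSpace G] in
/-- Measurability and the bound `|W_p| ≤ 1` of the plaquette variables and of their double and triple products. [folklore] -/
private theorem suN_zdPlaquetteObs_data (hρ : IsSpecialUnitaryModel ρ) (a b c : ZdPlaquette d) :
    (Measurable (𝔚 a) ∧ ∀ U, |𝔚 a U| ≤ 1) ∧
      (Measurable (fun U => 𝔚 a U * 𝔚 b U) ∧ ∀ U, |𝔚 a U * 𝔚 b U| ≤ 1) ∧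
      (Measurable (fun U => 𝔚 a U * 𝔚 b U * 𝔚 c U) ∧ ∀ U, |𝔚 a U * 𝔚 b U * 𝔚 c U| ≤ 1) := by
  have hm : ∀ r : ZdPlaquette d, Measurable (𝔚 r) := fun r => (continuous_zdPlaquetteObs (d := d) hρ.1 r).measurable
  have hb : ∀ (r : ZdPlaquette d) (U : ZdGaugeConfig d G), |𝔚 r U| ≤ 1 := fun r U =>
    abs_zdPlaquetteObs_le (IsSpecialUnitaryModel.mem_unitaryGroup ρ hρ) _ _ _ U
  have hb2 : ∀ U, |𝔚 a U * 𝔚 b U| ≤ 1 := fun U => by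
    rw [abs_mul]
    calc |𝔚 a U| * |𝔚 b U| ≤ 1 * 1 := mul_le_mul (hb a U) (hb b U) (abs_nonneg _) zero_le_one
      _ = 1 := one_mul 1
  refine ⟨⟨hm a, hb a⟩, ⟨(hm a).mul (hm b), hb2⟩, ⟨((hm a).mul (hm b)).mul (hm c), fun U => ?_⟩⟩
  rw [abs_mul]
  calc |𝔚 a U * 𝔚 b U| * |𝔚 c U| ≤ 1 * 1 := mul_le_mul (hb2 U) (hb c U) (abs_nonneg _) zero_le_one
    _ = 1 := one_mul 1

/-- ★★ **`SU(N)`, `N ≥ 3`, `N ≠ 4`, every `d`: the connected four-point function of plaquette variables VANISHES IDENTICALLY at `β = 0`**,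
`u₄(W_a; W_b; W_c; W_e)|_{dg_∞} = 0` (the means vanish, so `u₄` is the joint fourth cumulant of `suN_fourthCumulant_zdHaar`; the
third moments — non-zero for `SU(3)` — only ever occur multiplied by a mean). Contrast `SU(2)`: `−δ_{a=b=c=e}/16` (part 11b).
[folklore] -/
theorem suN_fourPoint_zdHaar (hρ : IsSpecialUnitaryModel ρ) (hn : 1 ≤ n) (h4 : ¬ (2 + n) ∣ 4) (a b c e : ZdPlaquette d) :
    U₄[𝔚 a ; 𝔚 b ; 𝔚 c ; 𝔚 e ; zdHaar d G] = 0 := by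
  classical
  obtain ⟨⟨hma, hba⟩, ⟨hmab, hbab⟩, ⟨hmabc, hbabc⟩⟩ := suN_zdPlaquetteObs_data (d := d) (G := G) hρ a b c
  obtain ⟨⟨hmb, hbb⟩, ⟨hmbc, hbbc⟩, -⟩ := suN_zdPlaquetteObs_data (d := d) (G := G) hρ b c c
  obtain ⟨⟨hmc, hbc⟩, ⟨hmce, hbce⟩, -⟩ := suN_zdPlaquetteObs_data (d := d) (G := G) hρ c e e
  obtain ⟨⟨hme, hbe⟩, -, -⟩ := suN_zdPlaquetteObs_data (d := d) (G := G) hρ e e e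
  obtain ⟨-, ⟨hmac, hbac⟩, -⟩ := suN_zdPlaquetteObs_data (d := d) (G := G) hρ a c c
  obtain ⟨-, ⟨hmae, hbae⟩, -⟩ := suN_zdPlaquetteObs_data (d := d) (G := G) hρ a e e
  obtain ⟨-, ⟨hmbe, hbbe⟩, -⟩ := suN_zdPlaquetteObs_data (d := d) (G := G) hρ b e e
  have h0 : ∀ r : ZdPlaquette d, ∫ U, 𝔚 r U ∂zdHaar d G = 0 := fun r =>
    PressureRegularity.integral_zdPlaquetteObs_zdHaar hρ (by omega) r
  have h4' := suN_fourthCumulant_zdHaar (d := d) (G := G) hρ hn h4 a b c e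
  simp only [h0, zero_mul, sub_zero]
  rw [CouplingResponse.covariance_eq_sub_of_abs_le hmabc hme hbabc hbe,
    CouplingResponse.covariance_eq_sub_of_abs_le hmc hme hbc hbe,
    CouplingResponse.covariance_eq_sub_of_abs_le hma hme hba hbe,
    CouplingResponse.covariance_eq_sub_of_abs_le hmb hmc hbb hbc,
    CouplingResponse.covariance_eq_sub_of_abs_le hmb hme hbb hbe,
    CouplingResponse.covariance_eq_sub_of_abs_le hma hmc hba hbc, h0 a, h0 b, h0 c, h0 e]
  linear_combination h4'

end CumulantsSUN

/-! ## The concrete group `SU(3)` -/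

section Concrete

open Literature.MathematicalPhysics.QuantumFieldTheory.TorusAreaLaw (isSpecialUnitaryModel_fundamentalRep)

variable {d : ℕ}

/-- `SU(3)` is second countable (closed subgroup of `3 × 3` complex matrices). [folklore] -/
private theorem secondCountable_su3'' : SecondCountableTopology (Matrix.specialUnitaryGroup (Fin 3) ℂ) :=
  haveI : SecondCountableTopology (Matrix (Fin 3) (Fin 3) ℂ) := inferInstanceAs (SecondCountableTopology (Fin 3 → Fin 3 → ℂ))
  Topology.IsEmbedding.subtypeVal.secondCountableTopology

/-- ★★ **`SU(3)` lattice gauge theory on `ℤ^d` at `β = 0`: the joint fourth cumulant of the plaquette variables `W_p = (1/3) Re tr U_p`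
vanishes identically.** [folklore] -/
theorem su3_fourthCumulant_zdHaar (a b c e : ZdPlaquette d) :
    ∫ U, zdPlaquetteObs (fundamentalRep (Fin 3)) a.1 a.2.1.1 a.2.1.2 U * zdPlaquetteObs (fundamentalRep (Fin 3)) b.1 b.2.1.1 b.2.1.2 U *
          zdPlaquetteObs (fundamentalRep (Fin 3)) c.1 c.2.1.1 c.2.1.2 U * zdPlaquetteObs (fundamentalRep (Fin 3)) e.1 e.2.1.1 e.2.1.2 U
          ∂zdHaar d (Matrix.specialUnitaryGroup (Fin 3) ℂ) -
        (∫ U, zdPlaquetteObs (fundamentalRep (Fin 3)) a.1 a.2.1.1 a.2.1.2 U *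
          zdPlaquetteObs (fundamentalRep (Fin 3)) b.1 b.2.1.1 b.2.1.2 U ∂zdHaar d (Matrix.specialUnitaryGroup (Fin 3) ℂ)) *
        (∫ U, zdPlaquetteObs (fundamentalRep (Fin 3)) c.1 c.2.1.1 c.2.1.2 U *
          zdPlaquetteObs (fundamentalRep (Fin 3)) e.1 e.2.1.1 e.2.1.2 U ∂zdHaar d (Matrix.specialUnitaryGroup (Fin 3) ℂ)) -
        (∫ U, zdPlaquetteObs (fundamentalRep (Fin 3)) a.1 a.2.1.1 a.2.1.2 U *
          zdPlaquetteObs (fundamentalRep (Fin 3)) c.1 c.2.1.1 c.2.1.2 U ∂zdHaar d (Matrix.specialUnitaryGroup (Fin 3) ℂ)) *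
        (∫ U, zdPlaquetteObs (fundamentalRep (Fin 3)) b.1 b.2.1.1 b.2.1.2 U *
          zdPlaquetteObs (fundamentalRep (Fin 3)) e.1 e.2.1.1 e.2.1.2 U ∂zdHaar d (Matrix.specialUnitaryGroup (Fin 3) ℂ)) -
        (∫ U, zdPlaquetteObs (fundamentalRep (Fin 3)) a.1 a.2.1.1 a.2.1.2 U *
          zdPlaquetteObs (fundamentalRep (Fin 3)) e.1 e.2.1.1 e.2.1.2 U ∂zdHaar d (Matrix.specialUnitaryGroup (Fin 3) ℂ)) *
        (∫ U, zdPlaquetteObs (fundamentalRep (Fin 3)) b.1 b.2.1.1 b.2.1.2 U *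
          zdPlaquetteObs (fundamentalRep (Fin 3)) c.1 c.2.1.1 c.2.1.2 U ∂zdHaar d (Matrix.specialUnitaryGroup (Fin 3) ℂ)) = 0 := by
  haveI := secondCountable_su3''
  exact suN_fourthCumulant_zdHaar (n := 1) (d := d) (isSpecialUnitaryModel_fundamentalRep 3) le_rfl (by norm_num) a b c e

/-- Local shorthand: `u₃` under `μ`, spelled out. -/
local notation3 (prettyPrint := false) "U₃'[" X ";" Y ";" Z ";" μ "]" =>
  cov[fun ω => X ω * Y ω, Z; μ] - (∫ ω, X ω ∂μ) * cov[Y, Z; μ] - (∫ ω, Y ω ∂μ) * cov[X, Z; μ]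

/-- ★★ **`SU(3)` lattice gauge theory on `ℤ^d` at `β = 0`: `u₄(W_a; W_b; W_c; W_e) = 0` for all plaquettes** (the tree's
derivative-form connected four-point function, g10 file G). [folklore] -/
theorem su3_fourPoint_zdHaar (a b c e : ZdPlaquette d) :
    (cov[fun U => (zdPlaquetteObs (fundamentalRep (Fin 3)) a.1 a.2.1.1 a.2.1.2 U *
        zdPlaquetteObs (fundamentalRep (Fin 3)) b.1 b.2.1.1 b.2.1.2 U) * zdPlaquetteObs (fundamentalRep (Fin 3)) c.1 c.2.1.1 c.2.1.2 U,
        zdPlaquetteObs (fundamentalRep (Fin 3)) e.1 e.2.1.1 e.2.1.2; zdHaar d (Matrix.specialUnitaryGroup (Fin 3) ℂ)] -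
      (∫ U, zdPlaquetteObs (fundamentalRep (Fin 3)) a.1 a.2.1.1 a.2.1.2 U * zdPlaquetteObs (fundamentalRep (Fin 3)) b.1 b.2.1.1 b.2.1.2 U
          ∂zdHaar d (Matrix.specialUnitaryGroup (Fin 3) ℂ)) *
        cov[zdPlaquetteObs (fundamentalRep (Fin 3)) c.1 c.2.1.1 c.2.1.2, zdPlaquetteObs (fundamentalRep (Fin 3)) e.1 e.2.1.1 e.2.1.2;
          zdHaar d (Matrix.specialUnitaryGroup (Fin 3) ℂ)] -
      (∫ U, zdPlaquetteObs (fundamentalRep (Fin 3)) c.1 c.2.1.1 c.2.1.2 U ∂zdHaar d (Matrix.specialUnitaryGroup (Fin 3) ℂ)) *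
        cov[fun U => zdPlaquetteObs (fundamentalRep (Fin 3)) a.1 a.2.1.1 a.2.1.2 U *
          zdPlaquetteObs (fundamentalRep (Fin 3)) b.1 b.2.1.1 b.2.1.2 U, zdPlaquetteObs (fundamentalRep (Fin 3)) e.1 e.2.1.1 e.2.1.2;
          zdHaar d (Matrix.specialUnitaryGroup (Fin 3) ℂ)])
    - cov[zdPlaquetteObs (fundamentalRep (Fin 3)) a.1 a.2.1.1 a.2.1.2, zdPlaquetteObs (fundamentalRep (Fin 3)) e.1 e.2.1.1 e.2.1.2;
        zdHaar d (Matrix.specialUnitaryGroup (Fin 3) ℂ)] *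
      cov[zdPlaquetteObs (fundamentalRep (Fin 3)) b.1 b.2.1.1 b.2.1.2, zdPlaquetteObs (fundamentalRep (Fin 3)) c.1 c.2.1.1 c.2.1.2;
        zdHaar d (Matrix.specialUnitaryGroup (Fin 3) ℂ)]
    - (∫ U, zdPlaquetteObs (fundamentalRep (Fin 3)) a.1 a.2.1.1 a.2.1.2 U ∂zdHaar d (Matrix.specialUnitaryGroup (Fin 3) ℂ)) *
      U₃'[zdPlaquetteObs (fundamentalRep (Fin 3)) b.1 b.2.1.1 b.2.1.2 ; zdPlaquetteObs (fundamentalRep (Fin 3)) c.1 c.2.1.1 c.2.1.2 ;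
        zdPlaquetteObs (fundamentalRep (Fin 3)) e.1 e.2.1.1 e.2.1.2 ; zdHaar d (Matrix.specialUnitaryGroup (Fin 3) ℂ)]
    - cov[zdPlaquetteObs (fundamentalRep (Fin 3)) b.1 b.2.1.1 b.2.1.2, zdPlaquetteObs (fundamentalRep (Fin 3)) e.1 e.2.1.1 e.2.1.2;
        zdHaar d (Matrix.specialUnitaryGroup (Fin 3) ℂ)] *
      cov[zdPlaquetteObs (fundamentalRep (Fin 3)) a.1 a.2.1.1 a.2.1.2, zdPlaquetteObs (fundamentalRep (Fin 3)) c.1 c.2.1.1 c.2.1.2;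
        zdHaar d (Matrix.specialUnitaryGroup (Fin 3) ℂ)]
    - (∫ U, zdPlaquetteObs (fundamentalRep (Fin 3)) b.1 b.2.1.1 b.2.1.2 U ∂zdHaar d (Matrix.specialUnitaryGroup (Fin 3) ℂ)) *
      U₃'[zdPlaquetteObs (fundamentalRep (Fin 3)) a.1 a.2.1.1 a.2.1.2 ; zdPlaquetteObs (fundamentalRep (Fin 3)) c.1 c.2.1.1 c.2.1.2 ;
        zdPlaquetteObs (fundamentalRep (Fin 3)) e.1 e.2.1.1 e.2.1.2 ; zdHaar d (Matrix.specialUnitaryGroup (Fin 3) ℂ)] = 0 := by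
  haveI := secondCountable_su3''
  exact suN_fourPoint_zdHaar (n := 1) (d := d) (isSpecialUnitaryModel_fundamentalRep 3) le_rfl (by norm_num) a b c e

/-- ★ **`SU(3)`, every `d`: the triple plaquette sum of `u₄` at `β = 0` vanishes**, `Σ'_q Σ'_r Σ'_s u₄(W_p; W_q; W_r; W_s)|_{dg_∞} = 0`
— the `β = 0` value of the fourth response of a plaquette (for `SU(2)` it is `−1/16`, part 12's input for `f⁗(0) = −6`; the `SU(3)`
C⁴ chain that would turn this into `f⁗(0) = 0` is not in the tree and is not claimed). [folklore] -/
theorem su3_tsum_fourPoint_zdHaar (p : ZdPlaquette d) :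
    ∑' q : ZdPlaquette d, ∑' r : ZdPlaquette d, ∑' s : ZdPlaquette d,
      ((cov[fun U => (zdPlaquetteObs (fundamentalRep (Fin 3)) p.1 p.2.1.1 p.2.1.2 U *
        zdPlaquetteObs (fundamentalRep (Fin 3)) q.1 q.2.1.1 q.2.1.2 U) * zdPlaquetteObs (fundamentalRep (Fin 3)) r.1 r.2.1.1 r.2.1.2 U,
        zdPlaquetteObs (fundamentalRep (Fin 3)) s.1 s.2.1.1 s.2.1.2; zdHaar d (Matrix.specialUnitaryGroup (Fin 3) ℂ)] -
      (∫ U, zdPlaquetteObs (fundamentalRep (Fin 3)) p.1 p.2.1.1 p.2.1.2 U * zdPlaquetteObs (fundamentalRep (Fin 3)) q.1 q.2.1.1 q.2.1.2 U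
          ∂zdHaar d (Matrix.specialUnitaryGroup (Fin 3) ℂ)) *
        cov[zdPlaquetteObs (fundamentalRep (Fin 3)) r.1 r.2.1.1 r.2.1.2, zdPlaquetteObs (fundamentalRep (Fin 3)) s.1 s.2.1.1 s.2.1.2;
          zdHaar d (Matrix.specialUnitaryGroup (Fin 3) ℂ)] -
      (∫ U, zdPlaquetteObs (fundamentalRep (Fin 3)) r.1 r.2.1.1 r.2.1.2 U ∂zdHaar d (Matrix.specialUnitaryGroup (Fin 3) ℂ)) *
        cov[fun U => zdPlaquetteObs (fundamentalRep (Fin 3)) p.1 p.2.1.1 p.2.1.2 U *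
          zdPlaquetteObs (fundamentalRep (Fin 3)) q.1 q.2.1.1 q.2.1.2 U, zdPlaquetteObs (fundamentalRep (Fin 3)) s.1 s.2.1.1 s.2.1.2;
          zdHaar d (Matrix.specialUnitaryGroup (Fin 3) ℂ)])
    - cov[zdPlaquetteObs (fundamentalRep (Fin 3)) p.1 p.2.1.1 p.2.1.2, zdPlaquetteObs (fundamentalRep (Fin 3)) s.1 s.2.1.1 s.2.1.2;
        zdHaar d (Matrix.specialUnitaryGroup (Fin 3) ℂ)] *
      cov[zdPlaquetteObs (fundamentalRep (Fin 3)) q.1 q.2.1.1 q.2.1.2, zdPlaquetteObs (fundamentalRep (Fin 3)) r.1 r.2.1.1 r.2.1.2;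
        zdHaar d (Matrix.specialUnitaryGroup (Fin 3) ℂ)]
    - (∫ U, zdPlaquetteObs (fundamentalRep (Fin 3)) p.1 p.2.1.1 p.2.1.2 U ∂zdHaar d (Matrix.specialUnitaryGroup (Fin 3) ℂ)) *
      U₃'[zdPlaquetteObs (fundamentalRep (Fin 3)) q.1 q.2.1.1 q.2.1.2 ; zdPlaquetteObs (fundamentalRep (Fin 3)) r.1 r.2.1.1 r.2.1.2 ;
        zdPlaquetteObs (fundamentalRep (Fin 3)) s.1 s.2.1.1 s.2.1.2 ; zdHaar d (Matrix.specialUnitaryGroup (Fin 3) ℂ)]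
    - cov[zdPlaquetteObs (fundamentalRep (Fin 3)) q.1 q.2.1.1 q.2.1.2, zdPlaquetteObs (fundamentalRep (Fin 3)) s.1 s.2.1.1 s.2.1.2;
        zdHaar d (Matrix.specialUnitaryGroup (Fin 3) ℂ)] *
      cov[zdPlaquetteObs (fundamentalRep (Fin 3)) p.1 p.2.1.1 p.2.1.2, zdPlaquetteObs (fundamentalRep (Fin 3)) r.1 r.2.1.1 r.2.1.2;
        zdHaar d (Matrix.specialUnitaryGroup (Fin 3) ℂ)]
    - (∫ U, zdPlaquetteObs (fundamentalRep (Fin 3)) q.1 q.2.1.1 q.2.1.2 U ∂zdHaar d (Matrix.specialUnitaryGroup (Fin 3) ℂ)) *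
      U₃'[zdPlaquetteObs (fundamentalRep (Fin 3)) p.1 p.2.1.1 p.2.1.2 ; zdPlaquetteObs (fundamentalRep (Fin 3)) r.1 r.2.1.1 r.2.1.2 ;
        zdPlaquetteObs (fundamentalRep (Fin 3)) s.1 s.2.1.1 s.2.1.2 ; zdHaar d (Matrix.specialUnitaryGroup (Fin 3) ℂ)]) = 0 := by
  simp only [su3_fourPoint_zdHaar, tsum_zero]

end Concrete

end Summit.Ventures.YMGap.ZeroCouplingMoments
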